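import Summits.ValiantsHypothesis.ValiantsHypothesis.Theorems.BarrierLeverChowThinRowsForestPrelims

/-!
# Route BarrierLever — item `ChowHitsThinRowPartitionMinorsR` (stmt-ValiantsHypothesis-21850, budget
# `h·h` affine forms): the ANTIPODAL GADGET REDUCTION of the pair rows

Helper file (`--supports stmt-ValiantsHypothesis-21850`; cell valiant-natproofs, rung V4, 𝒟-side;
seat val-np-p5 gen 28).  Closes NO item; definition-free.  Imports only
`…ChowThinRowsForestPrelims` (for `exists_ne_zero_det_add_smul_ne_zero`).

Conventions of items 21850 / 21882: `x_a = X (castAdd h a)`, `y_c = X (natAdd h c)` in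
`MvPolynomial (Fin (h+h)) ℂ`; the partition-matrix entry of `f` at a layout position `(u, w)` is
`coeff (E u w) f`, `E u w = Σ_{a ∈ u} single (castAdd h a) 1 + Σ_{c ∈ w} single (natAdd h c) 1`.

**The gadget.**  For a pair row `u i = {a, b}` the two affine forms `Y_i ± λ (x_a + x_b)` (SAME
`y`-part `Y_i`, opposite `x`-parts) multiply to `Y_i² - λ² (x_a + x_b)²`, and
`(x_a + x_b)² = x_a² + x_b² + 2 x_a x_b` has exactly one squarefree monomial.  Hence on thin rows
(`|u i'| ≤ 2`) the partition matrix of `F · ∏_{i ∈ T} (Y_i + λ X_i)(Y_i - λ X_i)` is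
`M₀ - 2 λ² N` with `M₀` the matrix of `F · ∏_T Y_i²` and `N` supported on the gadget rows `i ∈ T`,
`N[i, j] = coeff (E ∅ (w j)) (F · ∏_{T ∖ i} Y²)` (`coeff_sqX_mul`, `coeff_mul_prod_gadget`).
Consequently (`exists_lam_det_ne_zero`, one-parameter argument `λ² = 1/t` with
`exists_ne_zero_det_add_smul_ne_zero`): if the matrix `M̂` whose gadget rows are those of `N` and whose
other rows are those of `M₀` is nonsingular, then some `λ` makes the partition minor nonsingular, and
(`chowHitsHH_of_gadgetCertificate`) if `F` is a product of `m` affine forms with `m + 2|T| ≤ h·h`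
the layout is hit by `h·h` affine forms — item 21850's conclusion for that layout.  The gadgets
contribute NOTHING to the singleton rows and the pair row `u i` sees only its own gadget; this
removes the `x`-structure from the problem: `M̂` depends on `F` and the `Y_i` only.

WHAT THIS IS NOT: a certificate mechanism; item 21850 is NOT proved here; nothing on items 21882 /
19717, on crux stmt-ValiantsHypothesis-14610, or on `VP` versus `VNP`.
-/

set_option linter.dupNamespace false

namespace Summit.ValiantsHypothesis.ValiantsHypothesis.Theorems.BarrierLever.ChowThinHH

open Finset MvPolynomial
open Summit.ValiantsHypothesis.ValiantsHypothesis.Theorems.BarrierLever.ChowFactor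
  (partitionExpo_tsub_single_castAdd castAdd_mem_support_partitionExpo totalDegree_affine_le)
open Summit.ValiantsHypothesis.ValiantsHypothesis.Theorems.BarrierLever.ChowThinAll
  (exists_ne_zero_det_add_smul_ne_zero)

variable {h r : ℕ}

/-! ## 1. The square of a two-variable `x`-form has one squarefree monomial -/

/-- `coeff (E U W) (x_a · H) = [a ∈ U] · coeff (E (U.erase a) W) H`. -/
theorem coeff_Xx_mul (a : Fin h) (U W : Finset (Fin h)) (H : MvPolynomial (Fin (h + h)) ℂ) :
    coeff (∑ a' ∈ U, Finsupp.single (Fin.castAdd h a') 1 + ∑ c ∈ W, Finsupp.single (Fin.natAdd h c) 1)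
        (X (Fin.castAdd h a) * H) =
      if a ∈ U then coeff (∑ a' ∈ U.erase a, Finsupp.single (Fin.castAdd h a') 1 +
        ∑ c ∈ W, Finsupp.single (Fin.natAdd h c) 1) H else 0 := by
  classical
  rw [coeff_X_mul']
  by_cases ha : a ∈ U
  · rw [if_pos ((castAdd_mem_support_partitionExpo U W a).mpr ha), partitionExpo_tsub_single_castAdd,
      if_pos ha]
  · rw [if_neg (fun hm => ha ((castAdd_mem_support_partitionExpo U W a).mp hm)), if_neg ha]

/-- **The gadget monomial.**  For `|V| = 2` and a thin row `|U| ≤ 2`: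
`coeff (E U W) ((Σ_{a ∈ V} x_a)² · H) = [U = V] · 2 · coeff (E ∅ W) H`. -/
theorem coeff_sqX_mul (V U W : Finset (Fin h)) (hV : V.card = 2) (hU : U.card ≤ 2)
    (H : MvPolynomial (Fin (h + h)) ℂ) :
    coeff (∑ a ∈ U, Finsupp.single (Fin.castAdd h a) 1 + ∑ c ∈ W, Finsupp.single (Fin.natAdd h c) 1)
        ((∑ a ∈ V, X (Fin.castAdd h a)) ^ 2 * H) =
      if U = V then 2 * coeff (∑ a ∈ (∅ : Finset (Fin h)), Finsupp.single (Fin.castAdd h a) 1 +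
        ∑ c ∈ W, Finsupp.single (Fin.natAdd h c) 1) H else 0 := by
  classical
  obtain ⟨a, b, hab, rfl⟩ := Finset.card_eq_two.mp hV
  rw [Finset.sum_pair hab]
  have hexp : ((X (Fin.castAdd h a) + X (Fin.castAdd h b)) ^ 2 * H : MvPolynomial (Fin (h + h)) ℂ) =
      X (Fin.castAdd h a) * (X (Fin.castAdd h a) * H) + X (Fin.castAdd h b) * (X (Fin.castAdd h b) * H) +
        2 * (X (Fin.castAdd h a) * (X (Fin.castAdd h b) * H)) := by ring
  rw [hexp, coeff_add, coeff_add]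
  -- the two squares contribute nothing
  have hsq : ∀ c : Fin h, coeff (∑ a' ∈ U, Finsupp.single (Fin.castAdd h a') 1 +
        ∑ c' ∈ W, Finsupp.single (Fin.natAdd h c') 1)
      (X (Fin.castAdd h c) * (X (Fin.castAdd h c) * H)) = 0 := by
    intro c
    rw [coeff_Xx_mul]
    by_cases hc : c ∈ U
    · rw [if_pos hc, coeff_Xx_mul, if_neg (Finset.notMem_erase c U)]
    · rw [if_neg hc]
  have h2 : coeff (∑ a' ∈ U, Finsupp.single (Fin.castAdd h a') 1 + ∑ c' ∈ W, Finsupp.single (Fin.natAdd h c') 1)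
      (2 * (X (Fin.castAdd h a) * (X (Fin.castAdd h b) * H)) : MvPolynomial (Fin (h + h)) ℂ) =
      2 * coeff (∑ a' ∈ U, Finsupp.single (Fin.castAdd h a') 1 + ∑ c' ∈ W, Finsupp.single (Fin.natAdd h c') 1)
        (X (Fin.castAdd h a) * (X (Fin.castAdd h b) * H)) := by
    have e : (2 : MvPolynomial (Fin (h + h)) ℂ) = C 2 := by rw [map_ofNat]
    rw [e, coeff_C_mul]
  rw [hsq a, hsq b, zero_add, zero_add, h2, coeff_Xx_mul]
  by_cases ha : a ∈ U
  · rw [if_pos ha, coeff_Xx_mul]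
    by_cases hb : b ∈ U
    · have hbU : b ∈ U.erase a := Finset.mem_erase.mpr ⟨hab.symm, hb⟩
      rw [if_pos hbU]
      have hsub : ({a, b} : Finset (Fin h)) ⊆ U := by
        intro x hx
        rcases Finset.mem_insert.mp hx with rfl | hx
        · exact ha
        · rw [Finset.mem_singleton.mp hx]; exact hb
      have hUeq : U = {a, b} :=
        (Finset.eq_of_subset_of_card_le hsub (by rw [Finset.card_pair hab]; exact hU)).symm
      have hempty : (U.erase a).erase b = ∅ := by
        rw [hUeq, Finset.erase_insert (by rwa [Finset.mem_singleton]), Finset.erase_singleton]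
      rw [hempty, if_pos hUeq]
    · rw [if_neg (fun hm => hb (Finset.mem_of_mem_erase hm)), mul_zero, if_neg]
      rintro rfl
      exact hb (by simp)
  · rw [if_neg ha, mul_zero, if_neg]
    rintro rfl
    exact ha (by simp)

/-! ## 2. The partition matrix of `F · ∏ gadgets` on thin rows -/

/-- **Gadget expansion.**  Let `u` be injective, `T` a set of rows of size `2`,
`X_i = Σ_{a ∈ u i} x_a`, `Y_i` arbitrary polynomials, `F` arbitrary.  On a thin row `|U| ≤ 2`,
`coeff (E U W) (F · ∏_{i∈T} (Y_i + λX_i)(Y_i - λX_i))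
  = coeff (E U W) (F · ∏_{i∈T} Y_i²) - 2λ² · Σ_{i ∈ T} [u i = U] · coeff (E ∅ W) (F · ∏_{T∖i} Y_i²)`. -/
theorem coeff_mul_prod_gadget (u : Fin r → Finset (Fin h)) (T : Finset (Fin r))
    (hT : ∀ i ∈ T, (u i).card = 2) (F : MvPolynomial (Fin (h + h)) ℂ)
    (Y : Fin r → MvPolynomial (Fin (h + h)) ℂ) (lam : ℂ) (U W : Finset (Fin h)) (hU : U.card ≤ 2) :
    coeff (∑ a ∈ U, Finsupp.single (Fin.castAdd h a) 1 + ∑ c ∈ W, Finsupp.single (Fin.natAdd h c) 1)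
        (F * ∏ i ∈ T, ((Y i + C lam * ∑ a ∈ u i, X (Fin.castAdd h a)) *
          (Y i - C lam * ∑ a ∈ u i, X (Fin.castAdd h a)))) =
      coeff (∑ a ∈ U, Finsupp.single (Fin.castAdd h a) 1 + ∑ c ∈ W, Finsupp.single (Fin.natAdd h c) 1)
          (F * ∏ i ∈ T, Y i ^ 2) -
        2 * lam ^ 2 * ∑ i ∈ T, (if u i = U then
          coeff (∑ a ∈ (∅ : Finset (Fin h)), Finsupp.single (Fin.castAdd h a) 1 +
            ∑ c ∈ W, Finsupp.single (Fin.natAdd h c) 1) (F * ∏ i' ∈ T.erase i, Y i' ^ 2) else 0) := by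
  classical
  induction T using Finset.induction_on generalizing F with
  | empty => simp
  | insert i₀ T hi₀ ih =>
    have hT' : ∀ i ∈ T, (u i).card = 2 := fun i hi => hT i (Finset.mem_insert_of_mem hi)
    have hi₀2 : (u i₀).card = 2 := hT i₀ (Finset.mem_insert_self _ _)
    -- peel the gadget `i₀` into `F`
    rw [Finset.prod_insert hi₀, ← mul_assoc, ih hT' (F * ((Y i₀ + C lam * ∑ a ∈ u i₀, X (Fin.castAdd h a)) *
      (Y i₀ - C lam * ∑ a ∈ u i₀, X (Fin.castAdd h a))))]
    have hg : ((Y i₀ + C lam * ∑ a ∈ u i₀, X (Fin.castAdd h a)) *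
        (Y i₀ - C lam * ∑ a ∈ u i₀, X (Fin.castAdd h a)) : MvPolynomial (Fin (h + h)) ℂ) =
        Y i₀ ^ 2 - C (lam ^ 2) * (∑ a ∈ u i₀, X (Fin.castAdd h a)) ^ 2 := by
      rw [map_pow]; ring
    -- main term
    have hmain : coeff (∑ a ∈ U, Finsupp.single (Fin.castAdd h a) 1 + ∑ c ∈ W, Finsupp.single (Fin.natAdd h c) 1)
        (F * ((Y i₀ + C lam * ∑ a ∈ u i₀, X (Fin.castAdd h a)) *
          (Y i₀ - C lam * ∑ a ∈ u i₀, X (Fin.castAdd h a))) * ∏ i ∈ T, Y i ^ 2) =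
        coeff (∑ a ∈ U, Finsupp.single (Fin.castAdd h a) 1 + ∑ c ∈ W, Finsupp.single (Fin.natAdd h c) 1)
            (F * ∏ i ∈ insert i₀ T, Y i ^ 2) -
          lam ^ 2 * (if U = u i₀ then 2 * coeff (∑ a ∈ (∅ : Finset (Fin h)), Finsupp.single (Fin.castAdd h a) 1 +
            ∑ c ∈ W, Finsupp.single (Fin.natAdd h c) 1) (F * ∏ i ∈ T, Y i ^ 2) else 0) := by
      rw [hg, Finset.prod_insert hi₀]
      have e : (F * (Y i₀ ^ 2 - C (lam ^ 2) * (∑ a ∈ u i₀, X (Fin.castAdd h a)) ^ 2) * ∏ i ∈ T, Y i ^ 2 :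
          MvPolynomial (Fin (h + h)) ℂ) =
          F * (Y i₀ ^ 2 * ∏ i ∈ T, Y i ^ 2) -
            C (lam ^ 2) * ((∑ a ∈ u i₀, X (Fin.castAdd h a)) ^ 2 * (F * ∏ i ∈ T, Y i ^ 2)) := by ring
      rw [e, coeff_sub, coeff_C_mul, coeff_sqX_mul (u i₀) U W hi₀2 hU]
    -- correction terms
    have hcorr : ∀ i ∈ T, (if u i = U then coeff (∑ a ∈ (∅ : Finset (Fin h)), Finsupp.single (Fin.castAdd h a) 1 +
          ∑ c ∈ W, Finsupp.single (Fin.natAdd h c) 1)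
        (F * ((Y i₀ + C lam * ∑ a ∈ u i₀, X (Fin.castAdd h a)) *
          (Y i₀ - C lam * ∑ a ∈ u i₀, X (Fin.castAdd h a))) * ∏ i' ∈ T.erase i, Y i' ^ 2) else 0) =
        (if u i = U then coeff (∑ a ∈ (∅ : Finset (Fin h)), Finsupp.single (Fin.castAdd h a) 1 +
          ∑ c ∈ W, Finsupp.single (Fin.natAdd h c) 1)
          (F * ∏ i' ∈ (insert i₀ T).erase i, Y i' ^ 2) else 0) := by
      intro i hi
      split_ifs with hiU
      · have hne : i₀ ≠ i := fun e => hi₀ (e ▸ hi)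
        rw [Finset.erase_insert_of_ne hne, Finset.prod_insert (fun hm => hi₀ (Finset.mem_of_mem_erase hm)), hg]
        have e : (F * (Y i₀ ^ 2 - C (lam ^ 2) * (∑ a ∈ u i₀, X (Fin.castAdd h a)) ^ 2) * ∏ i' ∈ T.erase i, Y i' ^ 2 :
            MvPolynomial (Fin (h + h)) ℂ) =
            F * (Y i₀ ^ 2 * ∏ i' ∈ T.erase i, Y i' ^ 2) -
              C (lam ^ 2) * ((∑ a ∈ u i₀, X (Fin.castAdd h a)) ^ 2 * (F * ∏ i' ∈ T.erase i, Y i' ^ 2)) := by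
          ring
        rw [e, coeff_sub, coeff_C_mul, coeff_sqX_mul (u i₀) ∅ W hi₀2 (by simp), if_neg, mul_zero, sub_zero]
        intro h0
        have := congrArg Finset.card h0
        rw [Finset.card_empty, hi₀2] at this
        exact absurd this (by norm_num)
      · rfl
    rw [hmain, Finset.sum_congr rfl hcorr, Finset.sum_insert hi₀, Finset.erase_insert hi₀]
    by_cases hU0 : u i₀ = U
    · rw [if_pos hU0, if_pos hU0.symm]; ring
    · rw [if_neg hU0, if_neg (fun e => hU0 e.symm)]; ring

/-- For injective `u`, at most the row `i` itself has `u i' = u i` among the gadget rows. -/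
theorem sum_ite_eq_row (u : Fin r → Finset (Fin h)) (hu : Function.Injective u) (T : Finset (Fin r))
    (i : Fin r) (g : Fin r → ℂ) :
    (∑ i' ∈ T, if u i' = u i then g i' else 0) = if i ∈ T then g i else 0 := by
  classical
  have e : ∀ i' ∈ T, (if u i' = u i then g i' else 0) = if i' = i then g i' else 0 := by
    intro i' _
    by_cases hii : i' = i
    · subst hii; simp
    · rw [if_neg (fun e => hii (hu e)), if_neg hii]
  rw [Finset.sum_congr rfl e, Finset.sum_ite_eq']

/-! ## 3. The one-parameter argument: a nonsingular `M̂` gives a nonsingular partition minor -/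

/-- **Gadget reduction (matrix form).**  Rows `u` injective of size `≤ 2`, gadget rows `T` of size
`2`, `F` and `Y_i` arbitrary polynomials.  If the matrix `M̂` with rows
`coeff (E ∅ (w j)) (F · ∏_{T∖i} Y²)` (`i ∈ T`) and `coeff (E (u i) (w j)) (F · ∏_T Y²)` (`i ∉ T`)
is nonsingular, then for some `λ` the partition minor of `F · ∏_{i∈T} (Y_i + λX_i)(Y_i - λX_i)`
on the layout `(u, w)` is nonsingular. -/
theorem exists_lam_det_ne_zero (u w : Fin r → Finset (Fin h)) (hu : Function.Injective u)
    (hu2 : ∀ i, (u i).card ≤ 2) (T : Finset (Fin r)) (hT : ∀ i ∈ T, (u i).card = 2)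
    (F : MvPolynomial (Fin (h + h)) ℂ) (Y : Fin r → MvPolynomial (Fin (h + h)) ℂ)
    (hM : (Matrix.of fun i j : Fin r =>
        if i ∈ T then coeff (∑ a ∈ (∅ : Finset (Fin h)), Finsupp.single (Fin.castAdd h a) 1 +
            ∑ c ∈ w j, Finsupp.single (Fin.natAdd h c) 1) (F * ∏ i' ∈ T.erase i, Y i' ^ 2)
        else coeff (∑ a ∈ u i, Finsupp.single (Fin.castAdd h a) 1 +
            ∑ c ∈ w j, Finsupp.single (Fin.natAdd h c) 1) (F * ∏ i' ∈ T, Y i' ^ 2)).det ≠ 0) :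
    ∃ lam : ℂ, (Matrix.of fun i j : Fin r =>
        coeff (∑ a ∈ u i, Finsupp.single (Fin.castAdd h a) 1 + ∑ c ∈ w j, Finsupp.single (Fin.natAdd h c) 1)
          (F * ∏ i' ∈ T, ((Y i' + C lam * ∑ a ∈ u i', X (Fin.castAdd h a)) *
            (Y i' - C lam * ∑ a ∈ u i', X (Fin.castAdd h a))))).det ≠ 0 := by
  classical
  -- `M₀`, `N`
  set M₀ : Matrix (Fin r) (Fin r) ℂ := Matrix.of fun i j =>
    coeff (∑ a ∈ u i, Finsupp.single (Fin.castAdd h a) 1 + ∑ c ∈ w j, Finsupp.single (Fin.natAdd h c) 1)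
      (F * ∏ i' ∈ T, Y i' ^ 2) with hM₀
  set N : Matrix (Fin r) (Fin r) ℂ := Matrix.of fun i j =>
    coeff (∑ a ∈ (∅ : Finset (Fin h)), Finsupp.single (Fin.castAdd h a) 1 +
      ∑ c ∈ w j, Finsupp.single (Fin.natAdd h c) 1) (F * ∏ i' ∈ T.erase i, Y i' ^ 2) with hN
  -- `A₀` = `M̂` with gadget rows scaled by `-2`; `A₁` = gadget rows of `M₀`
  set A₀ : Matrix (Fin r) (Fin r) ℂ := Matrix.of fun i j => if i ∈ T then -2 * N i j else M₀ i j with hA₀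
  set A₁ : Matrix (Fin r) (Fin r) ℂ := Matrix.of fun i j => if i ∈ T then M₀ i j else 0 with hA₁
  have hA₀eq : A₀ = Matrix.diagonal (fun i => if i ∈ T then (-2 : ℂ) else 1) *
      (Matrix.of fun i j : Fin r =>
        if i ∈ T then coeff (∑ a ∈ (∅ : Finset (Fin h)), Finsupp.single (Fin.castAdd h a) 1 +
            ∑ c ∈ w j, Finsupp.single (Fin.natAdd h c) 1) (F * ∏ i' ∈ T.erase i, Y i' ^ 2)
        else coeff (∑ a ∈ u i, Finsupp.single (Fin.castAdd h a) 1 +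
            ∑ c ∈ w j, Finsupp.single (Fin.natAdd h c) 1) (F * ∏ i' ∈ T, Y i' ^ 2)) := by
    ext i j
    rw [Matrix.diagonal_mul, hA₀, Matrix.of_apply, Matrix.of_apply]
    split_ifs <;> simp [hN, hM₀]
  have hA₀det : A₀.det ≠ 0 := by
    rw [hA₀eq, Matrix.det_mul, Matrix.det_diagonal]
    refine mul_ne_zero (Finset.prod_ne_zero_iff.mpr fun i _ => ?_) hM
    split_ifs <;> norm_num
  obtain ⟨t, ht, hdet⟩ := exists_ne_zero_det_add_smul_ne_zero A₀ A₁ hA₀det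
  -- `λ` with `λ² = t⁻¹`
  obtain ⟨lam, hlam⟩ := IsAlgClosed.exists_pow_nat_eq (t⁻¹ : ℂ) (by norm_num : 0 < 2)
  have hlam0 : lam ≠ 0 := by
    intro e
    rw [e, zero_pow (by norm_num)] at hlam
    exact inv_ne_zero ht hlam.symm
  refine ⟨lam, ?_⟩
  -- the partition matrix equals `diag(λ² on T, 1 else) · (A₀ + t A₁)`
  have hmat : (Matrix.of fun i j : Fin r =>
        coeff (∑ a ∈ u i, Finsupp.single (Fin.castAdd h a) 1 + ∑ c ∈ w j, Finsupp.single (Fin.natAdd h c) 1)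
          (F * ∏ i' ∈ T, ((Y i' + C lam * ∑ a ∈ u i', X (Fin.castAdd h a)) *
            (Y i' - C lam * ∑ a ∈ u i', X (Fin.castAdd h a))))) =
      Matrix.diagonal (fun i => if i ∈ T then lam ^ 2 else 1) * (A₀ + t • A₁) := by
    ext i j
    rw [Matrix.diagonal_mul, Matrix.of_apply, coeff_mul_prod_gadget u T hT F Y lam (u i) (w j) (hu2 i),
      sum_ite_eq_row u hu T i, Matrix.add_apply, Matrix.smul_apply, hA₀, hA₁, Matrix.of_apply,
      Matrix.of_apply, smul_eq_mul]
    by_cases hi : i ∈ T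
    · rw [if_pos hi, if_pos hi, if_pos hi, if_pos hi]
      have ht2 : lam ^ 2 * t = 1 := by rw [hlam, inv_mul_cancel₀ ht]
      simp only [hM₀, hN, Matrix.of_apply]
      linear_combination (-(coeff (∑ a ∈ u i, Finsupp.single (Fin.castAdd h a) 1 +
        ∑ c ∈ w j, Finsupp.single (Fin.natAdd h c) 1) (F * ∏ i' ∈ T, Y i' ^ 2))) * ht2
    · rw [if_neg hi, if_neg hi, if_neg hi, if_neg hi]
      simp [hM₀]
  rw [hmat, Matrix.det_mul, Matrix.det_diagonal]
  refine mul_ne_zero (Finset.prod_ne_zero_iff.mpr fun i _ => ?_) hdet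
  split_ifs
  · exact pow_ne_zero _ hlam0
  · exact one_ne_zero


/-! ## 4. Packaging: `m + 2|T| ≤ h·h` affine forms as a `Fin (h·h)`-indexed family -/

/-- Distribute at most `N` affine forms (indexed by a Finset `s` of any type) over the slots `Fin N`,
padding with the constant form `1` (empty products). -/
theorem exists_fin_forms {α : Type*} [DecidableEq α] (s : Finset α) (N : ℕ) (hcard : s.card ≤ N)
    (φ : α → MvPolynomial (Fin (h + h)) ℂ) (hφ : ∀ x ∈ s, (φ x).totalDegree ≤ 1) :
    ∃ ℓ : Fin N → MvPolynomial (Fin (h + h)) ℂ, (∀ k, (ℓ k).totalDegree ≤ 1) ∧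
      ∏ k, ℓ k = ∏ x ∈ s, φ x := by
  classical
  have hc : Fintype.card s ≤ Fintype.card (Fin N) := by
    rw [Fintype.card_coe, Fintype.card_fin]; exact hcard
  obtain ⟨ι⟩ := Function.Embedding.nonempty_of_card_le hc
  refine ⟨fun k => ∏ x ∈ (Finset.univ : Finset s) with ι x = k, φ (x : α), ?_, ?_⟩
  · intro k
    by_cases hk : ∃ x : s, ι x = k
    · obtain ⟨x, hx⟩ := hk
      have hfil : ((Finset.univ : Finset s).filter fun x' => ι x' = k) = {x} := by
        ext x'
        simp only [Finset.mem_filter, Finset.mem_univ, true_and, Finset.mem_singleton]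
        constructor
        · intro e; exact ι.injective (e.trans hx.symm)
        · rintro rfl; exact hx
      simp only [hfil, Finset.prod_singleton]
      exact hφ _ x.2
    · have hfil : ((Finset.univ : Finset s).filter fun x' => ι x' = k) = ∅ := by
        ext x'
        simp only [Finset.mem_filter, Finset.mem_univ, true_and, Finset.notMem_empty, iff_false]
        exact fun e => hk ⟨x', e⟩
      simp only [hfil, Finset.prod_empty, totalDegree_one]
      exact Nat.zero_le _
  · rw [Finset.prod_fiberwise Finset.univ ι (fun x : s => φ (x : α))]
    exact Finset.prod_coe_sort s φ

/-- An affine `y`-form plus a multiple of `X_i = Σ_{a ∈ u i} x_a` is an affine form. -/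
theorem totalDegree_gadgetForm (β : Fin h → ℂ) (V : Finset (Fin h)) (μ : ℂ) :
    ((C 1 + ∑ c, C (β c) * X (Fin.natAdd h c)) + C μ * ∑ a ∈ V, X (Fin.castAdd h a) :
      MvPolynomial (Fin (h + h)) ℂ).totalDegree ≤ 1 := by
  classical
  have e : ((C 1 + ∑ c, C (β c) * X (Fin.natAdd h c)) + C μ * ∑ a ∈ V, X (Fin.castAdd h a) :
      MvPolynomial (Fin (h + h)) ℂ) =
      C 1 + ∑ v : Fin (h + h), C (Fin.append (fun a => if a ∈ V then μ else 0) β v) * X v := by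
    rw [Fin.sum_univ_add]
    simp only [Fin.append_left, Fin.append_right]
    rw [Finset.mul_sum]
    have e1 : ∑ a ∈ V, C μ * X (Fin.castAdd h a) =
        ∑ a : Fin h, C (if a ∈ V then μ else 0) * X (Fin.castAdd h a) := by
      rw [← Finset.sum_filter_add_sum_filter_not Finset.univ (fun a => a ∈ V)]
      rw [Finset.filter_univ_mem,
        Finset.sum_eq_zero (s := Finset.univ.filter fun a => a ∉ V) (fun a ha => by
          rw [Finset.mem_filter] at ha
          rw [if_neg ha.2, C_0, zero_mul]), add_zero]
      exact Finset.sum_congr rfl fun a ha => by rw [if_pos ha]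
    rw [e1]
    ring
  rw [e]
  exact totalDegree_affine_le _ _

/-- **Gadget reduction (Chow form).**  Thin layout `(u, w)` (`u` injective, `|u i| ≤ 2`), gadget rows
`T` (of size `2`), affine forms `φ_1, …, φ_m` with product `F`, affine `y`-forms
`Y_i = 1 + Σ_c β i c · y_c`, and `m + 2|T| ≤ h·h`.  If the reduced matrix `M̂` (gadget rows
`coeff (E ∅ (w j)) (F · ∏_{T∖i} Y²)`, other rows `coeff (E (u i) (w j)) (F · ∏_T Y²)`) is nonsingular,
then the layout is hit by `h·h` affine forms: item 21850's conclusion for `(u, w)`. -/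
theorem chowHitsHH_of_gadgetCertificate (u w : Fin r → Finset (Fin h)) (hu : Function.Injective u)
    (hu2 : ∀ i, (u i).card ≤ 2) (T : Finset (Fin r)) (hT : ∀ i ∈ T, (u i).card = 2)
    (m : ℕ) (φ : Fin m → MvPolynomial (Fin (h + h)) ℂ) (hφ : ∀ k, (φ k).totalDegree ≤ 1)
    (β : Fin r → Fin h → ℂ) (hbudget : m + 2 * T.card ≤ h * h)
    (hM : (Matrix.of fun i j : Fin r =>
        if i ∈ T then coeff (∑ a ∈ (∅ : Finset (Fin h)), Finsupp.single (Fin.castAdd h a) 1 +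
            ∑ c ∈ w j, Finsupp.single (Fin.natAdd h c) 1)
            ((∏ k, φ k) * ∏ i' ∈ T.erase i, (C 1 + ∑ c, C (β i' c) * X (Fin.natAdd h c)) ^ 2)
        else coeff (∑ a ∈ u i, Finsupp.single (Fin.castAdd h a) 1 +
            ∑ c ∈ w j, Finsupp.single (Fin.natAdd h c) 1)
            ((∏ k, φ k) * ∏ i' ∈ T, (C 1 + ∑ c, C (β i' c) * X (Fin.natAdd h c)) ^ 2)).det ≠ 0) :
    ∃ ℓ : Fin (h * h) → MvPolynomial (Fin (h + h)) ℂ, (∀ k, (ℓ k).totalDegree ≤ 1) ∧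
      (Matrix.of fun i j : Fin r => MvPolynomial.coeff
        (∑ a ∈ u i, Finsupp.single (Fin.castAdd h a) 1 +
          ∑ c ∈ w j, Finsupp.single (Fin.natAdd h c) 1) (∏ k, ℓ k)).det ≠ 0 := by
  classical
  obtain ⟨lam, hlam⟩ := exists_lam_det_ne_zero u w hu hu2 T hT (∏ k, φ k)
    (fun i => C 1 + ∑ c, C (β i c) * X (Fin.natAdd h c)) hM
  -- the forms, indexed by `Fin m ⊕ (Fin r × Bool)`
  set g : Fin m ⊕ (Fin r × Bool) → MvPolynomial (Fin (h + h)) ℂ := fun x =>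
    match x with
    | Sum.inl k => φ k
    | Sum.inr (i, true) => (C 1 + ∑ c, C (β i c) * X (Fin.natAdd h c)) + C lam * ∑ a ∈ u i, X (Fin.castAdd h a)
    | Sum.inr (i, false) => (C 1 + ∑ c, C (β i c) * X (Fin.natAdd h c)) + C (-lam) * ∑ a ∈ u i, X (Fin.castAdd h a)
    with hg
  set s : Finset (Fin m ⊕ (Fin r × Bool)) :=
    (Finset.univ : Finset (Fin m)).map Function.Embedding.inl ∪
      (T ×ˢ (Finset.univ : Finset Bool)).map Function.Embedding.inr with hs
  have hdisj : Disjoint ((Finset.univ : Finset (Fin m)).map Function.Embedding.inl)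
      ((T ×ˢ (Finset.univ : Finset Bool)).map (Function.Embedding.inr : Fin r × Bool ↪ Fin m ⊕ (Fin r × Bool))) :=
    Finset.disjoint_left.mpr fun x hx hx' => by
      obtain ⟨k, -, rfl⟩ := Finset.mem_map.mp hx
      obtain ⟨p, -, e⟩ := Finset.mem_map.mp hx'
      exact Sum.inr_ne_inl e
  have hcard : s.card ≤ h * h := by
    rw [hs, Finset.card_union_of_disjoint hdisj, Finset.card_map, Finset.card_map, Finset.card_univ,
      Fintype.card_fin, Finset.card_product, Finset.card_univ, Fintype.card_bool]
    linarith
  have hdeg : ∀ x ∈ s, (g x).totalDegree ≤ 1 := by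
    intro x _
    rcases x with k | ⟨i, b⟩
    · exact hφ k
    · cases b
      · exact totalDegree_gadgetForm (β i) (u i) (-lam)
      · exact totalDegree_gadgetForm (β i) (u i) lam
  obtain ⟨ℓ, hℓdeg, hℓprod⟩ := exists_fin_forms s (h * h) hcard g hdeg
  refine ⟨ℓ, hℓdeg, ?_⟩
  have hprod : ∏ x ∈ s, g x = (∏ k, φ k) *
      ∏ i' ∈ T, (((C 1 + ∑ c, C (β i' c) * X (Fin.natAdd h c)) + C lam * ∑ a ∈ u i', X (Fin.castAdd h a)) *
        ((C 1 + ∑ c, C (β i' c) * X (Fin.natAdd h c)) - C lam * ∑ a ∈ u i', X (Fin.castAdd h a))) := by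
    rw [hs, Finset.prod_union hdisj, Finset.prod_map, Finset.prod_map, Finset.prod_product]
    refine congrArg _ (Finset.prod_congr rfl fun i _ => ?_)
    rw [Fintype.prod_bool]
    simp only [hg, Function.Embedding.inr_apply, map_neg]
    ring
  rw [hℓprod, hprod]
  exact hlam
end Summit.ValiantsHypothesis.ValiantsHypothesis.Theorems.BarrierLever.ChowThinHH
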